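import Summits.ABC.IUTFork.Thm311RealInd1StripPacketDualBoxVolumePerImage
import Literature.IUT.LogVolume.GenuineLogThetaUnionTameContent
import Literature.IUT.LogVolume.GenuineLogThetaUnionSubIndeterminacy
import HarnessLib

/-!
# [IUTchIII] Thm 3.11 (i) (Ind1)+(Ind2) ⟶ Cor 3.12, READING (U) (the cell's reading of record): the FAILURE side QUANTIFIED — if every
# content-minimising slot of a tame collection fails its room inequality, the `(R_I)^∼`-hull of every factorwise-strip orbit of the (Ind1)-slot-union
# region `⋃_a ι_a(g_a)·(R_I)^∼` has `log μ̄` at least `(Σ_j f(L_j)/D)·log p` BELOW the hull of ALL possible images, and `ln ν̄_{𝕃_p}` of reading (U) over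
# `H` drops STRICTLY below `−|log(Θ)|_p` (UNCONDITIONAL)

PROOF-ONLY file (abc-iut cell, Cor. 3.12 sub-crew, seat abc-iut-c312-1 = holder of record of the typed [IUTchIII] Thm. 3.11, gen 21; offer (π′)
«C:VOLUME-FORM CONVERSE», file 4 — the reading-(U) twin of files 2–3 `Thm311RealInd1StripPacketDualBoxVolume{,PerImage}`, as R23 (p546301) was the
twin of R21/R22).  TAKES NO SIDE on [IUTchIII] Cor. 3.12.  No definition, no `Prop` fact, NO `JannsenWingbergMappingClass`: everything UNCONDITIONAL.

SETTING.  Genuine packet `X = ⊗_{b∈I} K_{w_b}`, every factor TAME; slot elements `g_a`, `‖g_a‖ = p^{−v_a/e_a}`, contents `A_a = (v_a − 1) div e_a + 1 − |I|`,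
`m = min_a A_a`; the slot union `M_U = ⋃_a ι_a(g_a)·(R_I)^∼` (at a genuine place-section collection: `⋃_σ σ·O_𝕃(−P_Θ)_{v⃗∘σ}`, abc-iut-c312-3
`realPrimePacketWith_indOneUnion_pilotRegion_eq_slotUnion`); its container hull (ALL possible images) is `packetHull(p^{m}·log_p(R_I^×))` at a tame
collection (R23 `GenuineLogThetaUnionTameContent`, unconditional).  `S ⊆ I` carries no bit hypothesis; off `S`: residue degree one, `e_b ≥ 2`, `hfix`;
`H` acts factorwise through the realised strip groups.

* §1 `prodRadius_lt_container_of_succ_le` — a slot `a` with `A_a ≥ m + 1` has R28's confinement radius `R′_{a,S}` below the union container's radius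
  `‖p^{m}‖·∏_b p^{−1/e_b}` WHATEVER its room inequality (`R′_{a,S} < p·R_a ≤ R_m`; pure arithmetic).
* §2 **`packetLogμ_packetHull_orbit_slotUnion_le_container_sub_of_not_room_at_min`** — if every slot `a` with `A_a = m` FAILS its room inequality
  `((v_a−1) % e_a + 1)/e_a + Σ_{b∉S} 1/e_b ≤ 1`, then the hull of the `H`-orbit of `M_U` is admissible and
  **`log μ̄(hull(H-orbit of M_U)) ≤ log μ̄(packetHull(p^{m}·log_p(R_I^×))) − (Σ_j f(L_j)/D)·log p`**, container value `−(m + Σ_b 1/e_b)·log p`: slot by slot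
  R28 (λ2) §2 confines the orbit of `ι_a(g_a)·(R_I)^∼` to the radius `R′_{a,S}`, `< R_m` by gen 19's `prodRadius_lt_container_of_not_room` at the
  minimising slots and by §1 at the others; the classical polydisc volume gap (`PacketPolydiscVolumeGap`) does the rest.
* §3 **`localFields_lnνLp_hull_orbitH_indOneUnion_le_negLogThetaAt_sub_of_not_room_at_min`** / **`…_lt_negLogThetaAt_…`** — genuine place-section
  packets, `H ≤ indTwo` everywhere; ONE collection `v⃗₁` (degree `j₁ ≤ ℓ⋆`) as in §2 ⟹
  `ln ν̄_{𝕃_p}(reading (U) over H) ≤ −|log(Θ)|_p − (1/ℓ⋆)·(Σ_j f_j/D)·log p·Π_b Pr(v_{1,b})`, hence `<` (abc-iut-c312-d1's (U)-shape and summandwise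
  lemmas `GenuineLogThetaUnionSubIndeterminacy` + R23's `realPrimePacketWith_possibleImagesHull_pilotRegion_eq_of_tame` + file 3's `lnνLp_le_sub_of_succ`).
READING (numbers about OUR typed objects; neutral): the (U)-twin of files 2–3 — R23 gives the identity `hull(H-orbit of M_U) = possibleImagesHull` (mod hMC)
where every content-minimising slot has room; here, when NONE of them has room (bits only on `S`), reading (U) over any factorwise-strip `H ≤ indTwo` is
STRICTLY below the container's `−|log(Θ)|_p`, by the displayed margin; mixed collections (some minimising slots with room, some without) are NOT treated.
Which value a bit takes is NOT claimed.  HONEST SCOPE: unconditional; tame factors; OUR typings (THE equivariant lift, THE logarithm, factorwise action;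
F-B28-1 untouched); EVEN degree (identity side), WILD, `p = 2` outside; equal-AS-TYPED ≠ equal in print; nothing here asserts that abc is proved or refuted; no
side taken on [IUTchIII] Cor. 3.12 / [IUTchIV] Thm. 1.10, on (U) vs (P), or on any author. [claim: Mochizuki2012, status: disputed];
[cite: Mochizuki2012, IUTchIII Thm. 3.11 (i) p. 154; Cor. 3.12 p. 174, Step (x) p. 181; IUTchIV Prop. 1.2 (ii) pp. 10–11, Prop. 1.4 (iii) p. 13];
[cite: DupuyHilado2025, Def. 3.6.3, §4.7, §4.9, §4.11, §4.12].  typed ≠ proved.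
-/

set_option autoImplicit false

noncomputable section

open Metric Set Function Module
open scoped Pointwise TensorProduct

namespace Summit.ABC.IUTFork.Thm311.Real

open NumberField IsDedekindDomain Literature.NumberTheory.NumberFields Literature.IUT.LogVolume
open Literature.NumberTheory.GaloisRepresentations Literature.NumberTheory.GaloisRepresentations.Ultrametric
open Literature.AnabelianGeometry.AbsoluteAnabelian Literature.IUT.HodgeArakelov
open Literature.IUT.HodgeArakelov.AbsTopMonoids

section Packet

variable {K : Type} [Field K] [NumberField K] (p : ℕ) [hp : Fact p.Prime]
variable {I : Type} [Fintype I] [DecidableEq I] (w : I → HeightOneSpectrum (𝓞 K)) (hw : ∀ i, ((p : ℕ) : 𝓞 K) ∈ (w i).asIdeal)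

/-! ## §1 Non-minimising slots are confined below the union container's radius -/

/-- **A slot of content `≥ m + 1` is confined below the union container's radius, room or no room**: `m + 1 ≤ A_a = (v−1) div e_a + 1 − |I|` ⟹
`R′_{a,S} = ∏_b p^{−[b=a]·v/e_b + 1 − 1/e_b − [b∉S]/e_b} < ‖p^{m}‖·∏_b p^{−1/e_b}` (the exponent of `R′_{a,S}` is `−B − (r+1)/e_a + |I| − Σ_b 1/e_b − Σ_{b∉S} 1/e_b`
with `v − 1 = e_a·B + r`, `0 ≤ r`). [cite: Mochizuki2012, IUTchIV Prop. 1.2 (ii) p. 10] -/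
theorem prodRadius_lt_container_of_succ_le (a : I) (v : ℤ) (S : Finset I) (m : ℤ)
    (hm : m + 1 ≤ (v - 1) / (absRamificationIdx p (RescaledCompletion K p (w a) (hw a)) : ℤ) + 1 - Fintype.card I) :
    ∏ i, (p : ℝ) ^ (-(if i = a then (v : ℝ) else 0) / (absRamificationIdx p (RescaledCompletion K p (w i) (hw i)) : ℝ) +
        (1 - 1 / (absRamificationIdx p (RescaledCompletion K p (w i) (hw i)) : ℝ) -
          if i ∈ S then 0 else 1 / (absRamificationIdx p (RescaledCompletion K p (w i) (hw i)) : ℝ))) <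
      ‖(p : ℚ_[p]) ^ m‖ * ∏ i, (p : ℝ) ^ (-(1 / (absRamificationIdx p (RescaledCompletion K p (w i) (hw i)) : ℝ))) := by
  classical
  set E : ℕ := absRamificationIdx p (RescaledCompletion K p (w a) (hw a)) with hE
  set ee : I → ℝ := fun i => (absRamificationIdx p (RescaledCompletion K p (w i) (hw i)) : ℝ) with hee
  have hP : p.Prime := Fact.out
  have hp0 : (0 : ℝ) < p := by exact_mod_cast hP.pos
  have hp1 : (1 : ℝ) < p := by exact_mod_cast hP.one_lt
  have hEpos : 0 < E := absRamificationIdx_pos p _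
  have hEz : (0 : ℤ) < (E : ℤ) := by exact_mod_cast hEpos
  have hE0 : (0 : ℝ) < (E : ℝ) := by exact_mod_cast hEpos
  -- `v − 1 = E·B + r`, `0 ≤ r`
  set B : ℤ := (v - 1) / (E : ℤ) with hB
  set r : ℤ := (v - 1) % (E : ℤ) with hr
  have hr0 : (0 : ℝ) ≤ r := by exact_mod_cast Int.emod_nonneg _ hEz.ne'
  have hvR : (v : ℝ) = (E : ℝ) * B + r + 1 := by
    have hvar : v - 1 = (E : ℤ) * B + r := by rw [hr, Int.emod_def]; ring
    have h1 : v = (E : ℤ) * B + r + 1 := by omega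
    exact_mod_cast h1
  have hmB : (m : ℝ) + Fintype.card I ≤ B := by
    have h1 : m + Fintype.card I ≤ B := by omega
    exact_mod_cast h1
  -- both sides as single powers of `p`
  rw [← Real.rpow_sum_of_pos hp0, ← Real.rpow_sum_of_pos hp0, norm_zpow, Padic.norm_p, inv_zpow', ← Real.rpow_intCast, ← Real.rpow_add hp0]
  refine Real.rpow_lt_rpow_of_exponent_lt hp1 ?_
  have hsh : ∑ i, (-(if i = a then (v : ℝ) else 0) / ee i) = -(v : ℝ) / (E : ℝ) := by
    rw [Finset.sum_congr rfl (fun i _ => show (-(if i = a then (v : ℝ) else 0) / ee i) = (if i = a then -(v : ℝ) / (E : ℝ) else 0) by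
      split_ifs with h
      · subst h; rfl
      · simp), Finset.sum_ite_eq' Finset.univ a, if_pos (Finset.mem_univ _)]
  have hS : ∑ i, (if i ∈ S then (0 : ℝ) else 1 / ee i) = ∑ i ∈ Finset.univ \ S, 1 / ee i := by
    rw [Finset.sum_congr rfl (fun i _ => show (if i ∈ S then (0 : ℝ) else 1 / ee i) = (if i ∈ Finset.univ \ S then 1 / ee i else 0) by
      simp only [Finset.mem_sdiff, Finset.mem_univ, true_and]
      split_ifs <;> rfl), Finset.sum_ite_mem, Finset.univ_inter]
  have hlhs : ∑ i, (-(if i = a then (v : ℝ) else 0) / ee i + (1 - 1 / ee i - if i ∈ S then 0 else 1 / ee i)) =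
      -(v : ℝ) / (E : ℝ) + Fintype.card I - ∑ i, 1 / ee i - ∑ i ∈ Finset.univ \ S, 1 / ee i := by
    rw [Finset.sum_add_distrib, hsh, Finset.sum_sub_distrib, Finset.sum_sub_distrib, hS, Finset.sum_const, Finset.card_univ, nsmul_eq_mul, mul_one]
    ring
  have hrhs : ∑ i, (-(1 / ee i)) = -∑ i, 1 / ee i := by rw [Finset.sum_neg_distrib]
  rw [hlhs, hrhs]
  push_cast
  have hSnn : 0 ≤ ∑ i ∈ Finset.univ \ S, 1 / ee i :=
    Finset.sum_nonneg fun i _ => by simp only [hee]; positivity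
  have hvE : -(v : ℝ) / (E : ℝ) = -(B : ℝ) - ((r : ℝ) + 1) / (E : ℝ) := by rw [hvR]; field_simp; ring
  have hfrac : 0 < ((r : ℝ) + 1) / (E : ℝ) := by positivity
  rw [hvE]
  linarith

/-! ## §2 The log-volume gap of the failure branch for the slot union -/

/-- **READING (U), FAILURE SIDE QUANTIFIED AT THE PACKET (UNCONDITIONAL).**  Genuine packet `⊗_{b∈I} K_{w_b}` of TAME factors of ANY residue degrees; slot
elements `‖g_a‖ = p^{−v_a/e_a}`, `A_a = (v_a−1) div e_a + 1 − |I|`, `m = min_a A_a`; `S ⊆ I` carries no bit hypothesis; off `S`: residue degree one, `e_b ≥ 2`, no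
realised strip automorphism moves `ℤ_p·p` modulo `p·log_p(𝒪^×)`; EVERY slot `a` with `A_a = m` FAILS its room inequality.  Then for EVERY `H ≤ Aut_{ℚ_p}(X)` acting
factorwise through the realised strip groups, the `(R_I)^∼`-hull of the `H`-orbit of the slot union `⋃_a ι_a(g_a)·(R_I)^∼` is admissible,
**`log μ̄(hull) ≤ log μ̄(packetHull(p^{m}·log_p(R_I^×))) − (Σ_j f(L_j)/D)·log p`**, and the container value is `−(m + Σ_b 1/e_b)·log p`.
[claim: Mochizuki2012, status: disputed] [cite: Mochizuki2012, IUTchIII Thm. 3.11 (i) p. 154; Cor. 3.12 p. 174; IUTchIV Prop. 1.2 (ii) p. 10, Prop. 1.4 (iii) p. 13]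
[cite: DupuyHilado2025, §4.7, §4.9, §4.11, §4.12] -/
theorem packetLogμ_packetHull_orbit_slotUnion_le_container_sub_of_not_room_at_min [Nonempty I] (hp2 : 2 < p)
    (he : ∀ i, absRamificationIdx p (RescaledCompletion K p (w i) (hw i)) ≤ p - 2)
    (g : Π i, RescaledCompletion K p (w i) (hw i)) (v : I → ℤ)
    (hg : ∀ i, ‖g i‖ = (p : ℝ) ^ (-(v i / (absRamificationIdx p (RescaledCompletion K p (w i) (hw i)) : ℝ))))
    (S : Finset I)
    (he2 : ∀ i, i ∉ S → 2 ≤ absRamificationIdx p (RescaledCompletion K p (w i) (hw i)))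
    (hf : ∀ i, i ∉ S → (w i).asIdeal.inertiaDeg ℤ = 1)
    (hfix : ∀ i, i ∉ S → ∀ ψ ∈ ind1StripOf (w i) (galoisLog (w i)),
      RescaledCompletion.of K p (w i) (hw i) (ψ (p : (w i).adicCompletion K)) - (p : RescaledCompletion K p (w i) (hw i)) ∈
        (p : ℚ_[p]) • logUnits (RescaledCompletion K p (w i) (hw i)))
    (hnotroom : ∀ a, (v a - 1) / (absRamificationIdx p (RescaledCompletion K p (w a) (hw a)) : ℤ) + 1 - Fintype.card I =
        Finset.univ.inf' Finset.univ_nonempty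
          (fun a => (v a - 1) / (absRamificationIdx p (RescaledCompletion K p (w a) (hw a)) : ℤ) + 1 - Fintype.card I) →
      ¬ ((((v a - 1) % (absRamificationIdx p (RescaledCompletion K p (w a) (hw a)) : ℤ) + 1 : ℤ) : ℝ) /
          (absRamificationIdx p (RescaledCompletion K p (w a) (hw a)) : ℝ) +
        ∑ i ∈ Finset.univ \ S, (1 : ℝ) / (absRamificationIdx p (RescaledCompletion K p (w i) (hw i)) : ℝ) ≤ 1))
    (H : Subgroup (PacketAlgebra p (fun i => RescaledCompletion K p (w i) (hw i)) ≃ₗ[ℚ_[p]]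
      PacketAlgebra p (fun i => RescaledCompletion K p (w i) (hw i))))
    (hHfac : ∀ γ ∈ H, ∃ δ : Π i, AddAut ((w i).adicCompletion K),
      (∀ i, δ i ∈ AddSubgroup.closure (G := AddAut ((w i).adicCompletion K)) (ind1StripOf (w i) (galoisLog (w i)))) ∧
      ∀ z : Π i, RescaledCompletion K p (w i) (hw i),
        γ (PiTensorProduct.tprod ℚ_[p] z) =
          PiTensorProduct.tprod ℚ_[p] (fun i => RescaledCompletion.of K p (w i) (hw i)
            (δ i ((RescaledCompletion.of K p (w i) (hw i)).symm (z i))))) :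
    PacketAdm p (fun i => RescaledCompletion K p (w i) (hw i))
        (packetHull p (fun i => RescaledCompletion K p (w i) (hw i))
          (⋃ γ : H, (γ : PacketAlgebra p (fun i => RescaledCompletion K p (w i) (hw i)) ≃ₗ[ℚ_[p]]
              PacketAlgebra p (fun i => RescaledCompletion K p (w i) (hw i))) ''
            ⋃ a, iota p (fun i => RescaledCompletion K p (w i) (hw i)) a (g a) •
              (normalizedPacket p (fun i => RescaledCompletion K p (w i) (hw i)) :
                Set (PacketAlgebra p (fun i => RescaledCompletion K p (w i) (hw i)))))) ∧
    packetLogμ p (fun i => RescaledCompletion K p (w i) (hw i))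
        (packetHull p (fun i => RescaledCompletion K p (w i) (hw i))
          (⋃ γ : H, (γ : PacketAlgebra p (fun i => RescaledCompletion K p (w i) (hw i)) ≃ₗ[ℚ_[p]]
              PacketAlgebra p (fun i => RescaledCompletion K p (w i) (hw i))) ''
            ⋃ a, iota p (fun i => RescaledCompletion K p (w i) (hw i)) a (g a) •
              (normalizedPacket p (fun i => RescaledCompletion K p (w i) (hw i)) :
                Set (PacketAlgebra p (fun i => RescaledCompletion K p (w i) (hw i)))))) ≤
      packetLogμ p (fun i => RescaledCompletion K p (w i) (hw i))
          (packetHull p (fun i => RescaledCompletion K p (w i) (hw i))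
            (((p : ℚ_[p]) ^ (Finset.univ.inf' Finset.univ_nonempty
                (fun a => (v a - 1) / (absRamificationIdx p (RescaledCompletion K p (w a) (hw a)) : ℤ) + 1 - Fintype.card I))) •
              (logPacket p (fun i => RescaledCompletion K p (w i) (hw i)) :
                Set (PacketAlgebra p (fun i => RescaledCompletion K p (w i) (hw i)))))) -
        (∑ j, (residueDegree p (DFac p (fun i => RescaledCompletion K p (w i) (hw i)) j) : ℝ)) /
          packetDegree p (DFac p (fun i => RescaledCompletion K p (w i) (hw i))) * Real.log p ∧
    packetLogμ p (fun i => RescaledCompletion K p (w i) (hw i))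
        (packetHull p (fun i => RescaledCompletion K p (w i) (hw i))
          (((p : ℚ_[p]) ^ (Finset.univ.inf' Finset.univ_nonempty
              (fun a => (v a - 1) / (absRamificationIdx p (RescaledCompletion K p (w a) (hw a)) : ℤ) + 1 - Fintype.card I))) •
            (logPacket p (fun i => RescaledCompletion K p (w i) (hw i)) :
              Set (PacketAlgebra p (fun i => RescaledCompletion K p (w i) (hw i)))))) =
      -(((Finset.univ.inf' Finset.univ_nonempty
            (fun a => (v a - 1) / (absRamificationIdx p (RescaledCompletion K p (w a) (hw a)) : ℤ) + 1 - Fintype.card I) : ℤ) : ℝ) *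
          Real.log p) +
        -(∑ i, 1 / (absRamificationIdx p (RescaledCompletion K p (w i) (hw i)) : ℝ)) * Real.log p := by
  classical
  set k := fun i => RescaledCompletion K p (w i) (hw i) with hk
  set A : I → ℤ := fun a => (v a - 1) / (absRamificationIdx p (k a) : ℤ) + 1 - Fintype.card I with hA
  set m : ℤ := Finset.univ.inf' Finset.univ_nonempty A with hm
  -- R28's confinement radius of the slot `a`
  set R' : I → ℝ := fun a => ∏ i, (p : ℝ) ^ (-(if i = a then (v a : ℝ) else 0) / (absRamificationIdx p (k i) : ℝ) +
    (1 - 1 / (absRamificationIdx p (k i) : ℝ) - if i ∈ S then 0 else 1 / (absRamificationIdx p (k i) : ℝ))) with hR'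
  -- every slot's orbit hull is confined to `R′_a`, and `R′_a <` the union container's radius
  have hconf : ∀ a, packetHull p k (⋃ γ : H, (γ : PacketAlgebra p k ≃ₗ[ℚ_[p]] PacketAlgebra p k) ''
      (iota p k a (g a) • (normalizedPacket p k : Set (PacketAlgebra p k)))) ⊆ dEquiv p k ⁻¹' polydisc (DFac p k) (fun _ => R' a) :=
    fun a => packetHull_orbit_smul_normalizedPacket_subset_polydisc_of_fixesBaseLine_off_mixed p w hw hp2 he a (hg a) S he2 hf hfix H hHfac
  have hlt : ∀ a, R' a < ‖(p : ℚ_[p]) ^ m‖ * ∏ i, (p : ℝ) ^ (-(1 / (absRamificationIdx p (k i) : ℝ))) := by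
    intro a
    have hle : m ≤ A a := Finset.inf'_le A (Finset.mem_univ a)
    by_cases ha : A a = m
    · have h := prodRadius_lt_container_of_not_room p w hw a (v a) S (hnotroom a ha)
      rw [show (v a - 1) / (absRamificationIdx p (k a) : ℤ) + 1 - Fintype.card I = m from ha] at h
      exact h
    · have hAa : A a = (v a - 1) / (absRamificationIdx p (RescaledCompletion K p (w a) (hw a)) : ℤ) + 1 - Fintype.card I := rfl
      exact prodRadius_lt_container_of_succ_le p w hw a (v a) S m (by omega)
  -- one radius for all slots
  set Rmax : ℝ := Finset.univ.sup' Finset.univ_nonempty R' with hRmax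
  have hRmax_lt : Rmax < ‖(p : ℚ_[p]) ^ m‖ * ∏ i, (p : ℝ) ^ (-(1 / (absRamificationIdx p (k i) : ℝ))) :=
    (Finset.sup'_lt_iff Finset.univ_nonempty).mpr fun a _ => hlt a
  have hU : (⋃ γ : H, (γ : PacketAlgebra p k ≃ₗ[ℚ_[p]] PacketAlgebra p k) ''
      ⋃ a, iota p k a (g a) • (normalizedPacket p k : Set (PacketAlgebra p k))) ⊆
        dEquiv p k ⁻¹' polydisc (DFac p k) (fun _ => Rmax) := by
    intro z hz
    obtain ⟨γ, hzγ⟩ := Set.mem_iUnion.mp hz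
    obtain ⟨x, hx, rfl⟩ := hzγ
    obtain ⟨a, hxa⟩ := Set.mem_iUnion.mp hx
    have h1 : (γ : PacketAlgebra p k ≃ₗ[ℚ_[p]] PacketAlgebra p k) x ∈
        packetHull p k (⋃ γ : H, (γ : PacketAlgebra p k ≃ₗ[ℚ_[p]] PacketAlgebra p k) ''
          (iota p k a (g a) • (normalizedPacket p k : Set (PacketAlgebra p k)))) :=
      subset_packetHull p k _ (Set.mem_iUnion.mpr ⟨γ, x, hxa, rfl⟩)
    have h2 := hconf a h1
    rw [Set.mem_preimage] at h2 ⊢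
    exact polydisc_mono (DFac p k) (fun _ => Finset.le_sup' R' (Finset.mem_univ a)) h2
  -- an admissible slot inside the union
  obtain ⟨a₀⟩ := ‹Nonempty I›
  have hg0 : g a₀ ≠ 0 := by
    rw [← norm_pos_iff, hg a₀]
    have hp0 : (0 : ℝ) < p := by exact_mod_cast (Fact.out : p.Prime).pos
    positivity
  have hM : PacketAdm p k (iota p k a₀ (g a₀) • (normalizedPacket p k : Set (PacketAlgebra p k))) :=
    packetAdm_iota_smul p k a₀ hg0 (packetAdm_normalizedPacket p k)
  have hMU : iota p k a₀ (g a₀) • (normalizedPacket p k : Set (PacketAlgebra p k)) ⊆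
      ⋃ γ : H, (γ : PacketAlgebra p k ≃ₗ[ℚ_[p]] PacketAlgebra p k) ''
        ⋃ a, iota p k a (g a) • (normalizedPacket p k : Set (PacketAlgebra p k)) := by
    intro x hx
    refine Set.mem_iUnion.mpr ⟨(1 : H), ?_⟩
    rw [OneMemClass.coe_one, LinearEquiv.coe_one, Set.image_id]
    exact Set.mem_iUnion.mpr ⟨a₀, hx⟩
  obtain ⟨hadm, hle, _⟩ :=
    packetLogμ_packetHull_le_container_sub_of_subset_preimage_polydisc_of_lt_of_tame p k hp2 he m hRmax_lt hM hMU hU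
  exact ⟨hadm, hle, packetLogμ_packetHull_zpow_smul_logPacket_of_tame p k hp2 he m⟩

end Packet

/-! ## §3 The genuine place-section packets: `ln ν̄_{𝕃_p}` of reading (U) over `H` drops strictly below `−|log(Θ)|_p` -/

section PlaceSection

variable {F₀ : Type} [Field F₀] [NumberField F₀] {K : Type} [Field K] [NumberField K] [Algebra F₀ K]
variable (σ : PlaceSection F₀ K) (p : ℕ) [hp : Fact p.Prime]
variable (c : (j : ℕ) → (Fin (j + 1) → placesOver F₀ p) → ℚ_[p]) (hc0 : ∀ j e, c j e ≠ 0)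
  (hcσ : ∀ (j : ℕ) (τ : Equiv.Perm (Fin (j + 1))) (e : Fin (j + 1) → placesOver F₀ p), c j (e ∘ τ) = c j e)

/-- **ONE COLLECTION WITHOUT ROOM AT ITS MINIMISING SLOTS ⟹ READING (U) OVER `H` DROPS BELOW `−|log(Θ)|_p` BY AN EXPLICIT MARGIN (UNCONDITIONAL).**
Real prime packet over the genuine completions of a place section (any shell `c`), Θ-idele `t`, family `H ≤ indTwo`.  If at ONE degree `j₁ = i₁+1 ≤ ℓ⋆`
and ONE collection `v⃗₁ = e₁` every factor is TAME, `‖t_{i₁,v_{1,a}}‖ = p^{−v_a/e_a}` at every slot, bits only on `S`, every content-minimising slot FAILS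
its room inequality, and `H_{j₁,v⃗₁}` acts factorwise through the realised strip groups, then (abc-iut-c312-d1's reading-(U) `H`-shape)
`ln ν̄_{𝕃_p}(v⃗ ↦ hull(⋃_{g∈H_{v⃗}} g(⋃_σ σ·O_𝕃(−P_Θ)_{v⃗∘σ}))) ≤ −|log(Θ)|_p − (1/ℓ⋆)·((Σ_j f(L_j)/D)·log p)·Π_b Pr(v_{1,b})`.
[claim: Mochizuki2012, status: disputed] [cite: Mochizuki2012, IUTchIII Thm. 3.11 (i) p. 154; Cor. 3.12 p. 174] [cite: DupuyHilado2025, Def. 3.6.3, §4.7, §4.11, §4.12] -/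
theorem localFields_lnνLp_hull_orbitH_indOneUnion_le_negLogThetaAt_sub_of_not_room_at_min (hp2 : 2 < p) {lstar : ℕ}
    (t : Fin lstar → (v : placesOver F₀ p) → ((σ.localFields p).k v)ˣ)
    (H : (j : ℕ) → (e : Fin (j + 1) → placesOver F₀ p) →
      Subgroup (PacketAlgebra p (fun b => (σ.localFields p).k (e b)) ≃ₗ[ℚ_[p]]
        PacketAlgebra p (fun b => (σ.localFields p).k (e b))))
    (hH : ∀ j e, H j e ≤ indTwo p (fun b => (σ.localFields p).k (e b)))
    (i₁ : Fin lstar) (e₁ : Fin ((i₁ : ℕ) + 1 + 1) → placesOver F₀ p)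
    (he : ∀ b, absRamificationIdx p ((σ.localFields p).k (e₁ b)) ≤ p - 2)
    (v : Fin ((i₁ : ℕ) + 1 + 1) → ℤ)
    (hv : ∀ a, ‖(t i₁ (e₁ a) : (σ.localFields p).k (e₁ a))‖ =
      (p : ℝ) ^ (-(v a / (absRamificationIdx p ((σ.localFields p).k (e₁ a)) : ℝ))))
    (S : Finset (Fin ((i₁ : ℕ) + 1 + 1)))
    (he2 : ∀ b, b ∉ S → 2 ≤ absRamificationIdx p ((σ.localFields p).k (e₁ b)))
    (hf : ∀ b, b ∉ S → (σ.lift (e₁ b).1).asIdeal.inertiaDeg ℤ = 1)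
    (hfix : ∀ b, b ∉ S → ∀ ψ ∈ ind1StripOf (σ.lift (e₁ b).1) (galoisLog (σ.lift (e₁ b).1)),
      RescaledCompletion.of K p (σ.lift (e₁ b).1) (σ.natCast_mem_lift (e₁ b)) (ψ (p : (σ.lift (e₁ b).1).adicCompletion K)) -
          (p : RescaledCompletion K p (σ.lift (e₁ b).1) (σ.natCast_mem_lift (e₁ b))) ∈
        (p : ℚ_[p]) • logUnits (RescaledCompletion K p (σ.lift (e₁ b).1) (σ.natCast_mem_lift (e₁ b))))
    (hnotroom : ∀ a, (v a - 1) / (absRamificationIdx p ((σ.localFields p).k (e₁ a)) : ℤ) + 1 - Fintype.card (Fin ((i₁ : ℕ) + 1 + 1)) =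
        Finset.univ.inf' Finset.univ_nonempty
          (fun a => (v a - 1) / (absRamificationIdx p ((σ.localFields p).k (e₁ a)) : ℤ) + 1 - Fintype.card (Fin ((i₁ : ℕ) + 1 + 1))) →
      ¬ ((((v a - 1) % (absRamificationIdx p ((σ.localFields p).k (e₁ a)) : ℤ) + 1 : ℤ) : ℝ) /
          (absRamificationIdx p ((σ.localFields p).k (e₁ a)) : ℝ) +
        ∑ b ∈ Finset.univ \ S, (1 : ℝ) / (absRamificationIdx p ((σ.localFields p).k (e₁ b)) : ℝ) ≤ 1))
    (hHfac : ∀ γ ∈ H ((i₁ : ℕ) + 1) e₁, ∃ δ : Π b, AddAut ((σ.lift (e₁ b).1).adicCompletion K),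
      (∀ b, δ b ∈ AddSubgroup.closure (G := AddAut ((σ.lift (e₁ b).1).adicCompletion K))
        (ind1StripOf (σ.lift (e₁ b).1) (galoisLog (σ.lift (e₁ b).1)))) ∧
      ∀ z : Π b, (σ.localFields p).k (e₁ b),
        (γ : PacketAlgebra p (fun b => (σ.localFields p).k (e₁ b)) ≃ₗ[ℚ_[p]]
            PacketAlgebra p (fun b => (σ.localFields p).k (e₁ b))) (PiTensorProduct.tprod ℚ_[p] z) =
          PiTensorProduct.tprod ℚ_[p] (fun b => RescaledCompletion.of K p (σ.lift (e₁ b).1) (σ.natCast_mem_lift (e₁ b))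
            (δ b ((RescaledCompletion.of K p (σ.lift (e₁ b).1) (σ.natCast_mem_lift (e₁ b))).symm (z b))))) :
    (realPrimePacketWith p (σ.localFields p) c hc0 hcσ).lnνLp lstar (fun j e =>
        packetHull p (fun b => (σ.localFields p).k (e b))
          (⋃ g : H j e, (g : PacketAlgebra p (fun b => (σ.localFields p).k (e b)) ≃ₗ[ℚ_[p]]
              PacketAlgebra p (fun b => (σ.localFields p).k (e b))) ''
            ⋃ τ : Equiv.Perm (Fin (j + 1)), (realPrimePacketWith p (σ.localFields p) c hc0 hcσ).perm τ e ''
              (realPrimePacketWith p (σ.localFields p) c hc0 hcσ).pilotRegion t j (e ∘ τ))) ≤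
      (realPrimePacketWith p (σ.localFields p) c hc0 hcσ).negLogThetaAt lstar t -
        (1 / (lstar : ℝ)) *
          (((∑ j, (residueDegree p (DFac p (fun b => (σ.localFields p).k (e₁ b)) j) : ℝ)) /
              packetDegree p (DFac p (fun b => (σ.localFields p).k (e₁ b))) * Real.log p) *
            ∏ b, weight F₀ (e₁ b).1) := by
  unfold PrimePacket.negLogThetaAt
  -- the slot-union rewriting of abc-iut-c312-d1's (U)-shape, at every summand
  have hUe : ∀ (i : Fin lstar) (e : Fin ((i : ℕ) + 1 + 1) → placesOver F₀ p),
      (⋃ τ : Equiv.Perm (Fin ((i : ℕ) + 1 + 1)),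
        ((realPrimePacketWith p (σ.localFields p) c hc0 hcσ).perm τ e ''
          (realPrimePacketWith p (σ.localFields p) c hc0 hcσ).pilotRegion t ((i : ℕ) + 1) (e ∘ τ) :
            Set (PacketAlgebra p (fun b => (σ.localFields p).k (e b))))) =
        ⋃ a : Fin ((i : ℕ) + 1 + 1), iota p (fun b => (σ.localFields p).k (e b)) a (t i (e a) : (σ.localFields p).k (e a)) •
          (normalizedPacket p (fun b => (σ.localFields p).k (e b)) : Set (PacketAlgebra p (fun b => (σ.localFields p).k (e b)))) :=
    fun i e => realPrimePacketWith_indOneUnion_pilotRegion_eq_slotUnion p (σ.localFields p) c hc0 hcσ t i e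
  refine lnνLp_le_sub_of_succ (realPrimePacketWith p (σ.localFields p) c hc0 hcσ) lstar (fun i e => ?_) i₁ e₁ ?_
  · obtain ⟨m, -, -, -, hadm, -⟩ := realPrimePacketWith_exists_content_logμ_possibleImagesHull p (σ.localFields p) c hc0 hcσ t i e
    show PacketAdm p (fun b => (σ.localFields p).k (e b)) _ ∧ _ ∧
      packetHull p (fun b => (σ.localFields p).k (e b)) _ ⊆ packetHull p (fun b => (σ.localFields p).k (e b)) _
    rw [hUe i e]
    exact ⟨packetAdm_hull_orbitH_slotUnion p (σ.localFields p) t i e (H _ e) (hH _ e), hadm,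
      packetHull_mono p _ (realPrimePacketWith_orbitH_slotUnion_subset_possibleImages p (σ.localFields p) c hc0 hcσ t i e (H _ e) (hH _ e))⟩
  · show packetLogμ p (fun b => (σ.localFields p).k (e₁ b)) _ ≤
      packetLogμ p (fun b => (σ.localFields p).k (e₁ b))
        ((realPrimePacketWith p (σ.localFields p) c hc0 hcσ).possibleImagesHull
          ((realPrimePacketWith p (σ.localFields p) c hc0 hcσ).pilotRegion t) ((i₁ : ℕ) + 1) e₁) - _
    rw [hUe i₁ e₁, realPrimePacketWith_possibleImagesHull_pilotRegion_eq_of_tame p (σ.localFields p) c hc0 hcσ hp2 t i₁ e₁ he v hv]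
    haveI : Nonempty (Fin ((i₁ : ℕ) + 1 + 1)) := ⟨Fin.last _⟩
    obtain ⟨-, hle, -⟩ := packetLogμ_packetHull_orbit_slotUnion_le_container_sub_of_not_room_at_min p (fun b => σ.lift (e₁ b).1)
      (fun b => σ.natCast_mem_lift (e₁ b)) hp2 he (fun a => (t i₁ (e₁ a) : (σ.localFields p).k (e₁ a))) v hv S he2 hf hfix hnotroom
      (H _ e₁) hHfac
    exact hle

/-- **Hence STRICTLY below `−|log(Θ)|_p`** under the same hypotheses (every `Pr(v) > 0`, `ℓ⋆ ≥ 1`, margin `> 0`); with abc-iut-c312-d1's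
`realPrimePacketWith_lnνLp_hull_orbitH_slotUnion_le_negLogThetaAt` (always `≤`), [IUTchIII] Cor. 3.12 in reading (U) over such an `H` is strictly harder than
over the container at this prime. [claim: Mochizuki2012, status: disputed] [cite: Mochizuki2012, IUTchIII Cor. 3.12 p. 174] [cite: DupuyHilado2025, Def. 3.6.3, §4.11, §4.12] -/
theorem localFields_lnνLp_hull_orbitH_indOneUnion_lt_negLogThetaAt_of_not_room_at_min (hp2 : 2 < p) {lstar : ℕ}
    (t : Fin lstar → (v : placesOver F₀ p) → ((σ.localFields p).k v)ˣ)
    (H : (j : ℕ) → (e : Fin (j + 1) → placesOver F₀ p) →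
      Subgroup (PacketAlgebra p (fun b => (σ.localFields p).k (e b)) ≃ₗ[ℚ_[p]]
        PacketAlgebra p (fun b => (σ.localFields p).k (e b))))
    (hH : ∀ j e, H j e ≤ indTwo p (fun b => (σ.localFields p).k (e b)))
    (i₁ : Fin lstar) (e₁ : Fin ((i₁ : ℕ) + 1 + 1) → placesOver F₀ p)
    (he : ∀ b, absRamificationIdx p ((σ.localFields p).k (e₁ b)) ≤ p - 2)
    (v : Fin ((i₁ : ℕ) + 1 + 1) → ℤ)
    (hv : ∀ a, ‖(t i₁ (e₁ a) : (σ.localFields p).k (e₁ a))‖ =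
      (p : ℝ) ^ (-(v a / (absRamificationIdx p ((σ.localFields p).k (e₁ a)) : ℝ))))
    (S : Finset (Fin ((i₁ : ℕ) + 1 + 1)))
    (he2 : ∀ b, b ∉ S → 2 ≤ absRamificationIdx p ((σ.localFields p).k (e₁ b)))
    (hf : ∀ b, b ∉ S → (σ.lift (e₁ b).1).asIdeal.inertiaDeg ℤ = 1)
    (hfix : ∀ b, b ∉ S → ∀ ψ ∈ ind1StripOf (σ.lift (e₁ b).1) (galoisLog (σ.lift (e₁ b).1)),
      RescaledCompletion.of K p (σ.lift (e₁ b).1) (σ.natCast_mem_lift (e₁ b)) (ψ (p : (σ.lift (e₁ b).1).adicCompletion K)) -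
          (p : RescaledCompletion K p (σ.lift (e₁ b).1) (σ.natCast_mem_lift (e₁ b))) ∈
        (p : ℚ_[p]) • logUnits (RescaledCompletion K p (σ.lift (e₁ b).1) (σ.natCast_mem_lift (e₁ b))))
    (hnotroom : ∀ a, (v a - 1) / (absRamificationIdx p ((σ.localFields p).k (e₁ a)) : ℤ) + 1 - Fintype.card (Fin ((i₁ : ℕ) + 1 + 1)) =
        Finset.univ.inf' Finset.univ_nonempty
          (fun a => (v a - 1) / (absRamificationIdx p ((σ.localFields p).k (e₁ a)) : ℤ) + 1 - Fintype.card (Fin ((i₁ : ℕ) + 1 + 1))) →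
      ¬ ((((v a - 1) % (absRamificationIdx p ((σ.localFields p).k (e₁ a)) : ℤ) + 1 : ℤ) : ℝ) /
          (absRamificationIdx p ((σ.localFields p).k (e₁ a)) : ℝ) +
        ∑ b ∈ Finset.univ \ S, (1 : ℝ) / (absRamificationIdx p ((σ.localFields p).k (e₁ b)) : ℝ) ≤ 1))
    (hHfac : ∀ γ ∈ H ((i₁ : ℕ) + 1) e₁, ∃ δ : Π b, AddAut ((σ.lift (e₁ b).1).adicCompletion K),
      (∀ b, δ b ∈ AddSubgroup.closure (G := AddAut ((σ.lift (e₁ b).1).adicCompletion K))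
        (ind1StripOf (σ.lift (e₁ b).1) (galoisLog (σ.lift (e₁ b).1)))) ∧
      ∀ z : Π b, (σ.localFields p).k (e₁ b),
        (γ : PacketAlgebra p (fun b => (σ.localFields p).k (e₁ b)) ≃ₗ[ℚ_[p]]
            PacketAlgebra p (fun b => (σ.localFields p).k (e₁ b))) (PiTensorProduct.tprod ℚ_[p] z) =
          PiTensorProduct.tprod ℚ_[p] (fun b => RescaledCompletion.of K p (σ.lift (e₁ b).1) (σ.natCast_mem_lift (e₁ b))
            (δ b ((RescaledCompletion.of K p (σ.lift (e₁ b).1) (σ.natCast_mem_lift (e₁ b))).symm (z b))))) :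
    (realPrimePacketWith p (σ.localFields p) c hc0 hcσ).lnνLp lstar (fun j e =>
        packetHull p (fun b => (σ.localFields p).k (e b))
          (⋃ g : H j e, (g : PacketAlgebra p (fun b => (σ.localFields p).k (e b)) ≃ₗ[ℚ_[p]]
              PacketAlgebra p (fun b => (σ.localFields p).k (e b))) ''
            ⋃ τ : Equiv.Perm (Fin (j + 1)), (realPrimePacketWith p (σ.localFields p) c hc0 hcσ).perm τ e ''
              (realPrimePacketWith p (σ.localFields p) c hc0 hcσ).pilotRegion t j (e ∘ τ))) <
      (realPrimePacketWith p (σ.localFields p) c hc0 hcσ).negLogThetaAt lstar t := by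
  have hle := localFields_lnνLp_hull_orbitH_indOneUnion_le_negLogThetaAt_sub_of_not_room_at_min σ p c hc0 hcσ hp2 t H hH i₁ e₁ he v hv S
    he2 hf hfix hnotroom hHfac
  haveI : Nonempty (Fin ((i₁ : ℕ) + 1 + 1)) := ⟨Fin.last _⟩
  have hmar := margin_pos p (fun b => (σ.localFields p).k (e₁ b))
  have hl : (0 : ℝ) < 1 / (lstar : ℝ) := by
    have : 0 < lstar := lt_of_le_of_lt (Nat.zero_le _) i₁.2
    positivity
  have hw : 0 < ∏ b, weight F₀ (e₁ b).1 := by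
    refine Finset.prod_pos fun b _ => ?_
    unfold weight
    have h1 : (0 : ℝ) < localDegree F₀ (e₁ b).1 := by exact_mod_cast localDegree_pos F₀ (e₁ b).1
    have h2 : (0 : ℝ) < Module.finrank ℚ F₀ := by exact_mod_cast Module.finrank_pos
    exact div_pos h1 h2
  have hpos : 0 < (1 / (lstar : ℝ)) *
      (((∑ j, (residueDegree p (DFac p (fun b => (σ.localFields p).k (e₁ b)) j) : ℝ)) /
          packetDegree p (DFac p (fun b => (σ.localFields p).k (e₁ b))) * Real.log p) *
        ∏ b, weight F₀ (e₁ b).1) := mul_pos hl (mul_pos hmar hw)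
  linarith

end PlaceSection

end Summit.ABC.IUTFork.Thm311.Real

end
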